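import Summits.QuantumFields.BalabanUV.Beta.SpineRootedStepN
import Summits.QuantumFields.BalabanUV.Beta.SpineRootedBmCoarseWiring

/-!
# The ROOTED first-order spine in the NATIVE placement — part D: the block-mean co-dressed family `JsBalBmNAtOf := dressBmAt ρ ∘ JsBal⁰♮_ρ`
# and the `hR` wiring `axisReflectionCovariant_flipK_TbalOf_JsBalBmNAtOf_ctrC` over the coarse coordinate projector `axEc`
# (twin of `SpineRootedBm` §1 + `SpineRootedBmCoarseWiring`; β sub-cell, row BETA-an2, gen 14; NOTE X-an2-45 / proposed (R45-1))

HONEST FRAMING (cell charter, verbatim): «discharging BetaPertH makes Balaban's UV stability UNCONDITIONAL — a real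
constructive-QFT result; it is NOT the continuum limit and NOT the Clay problem.»  DERIVED cell leaf (pub-balaban β sub-cell, lane
an2 gen 14); no statement of Bałaban's papers is typed here, no `[cite:]` tag, no `Prop` fact; it instantiates no binder of the
β-function wall by itself.  NOT `BetaPertH`; NOT continuum; NOT Clay.

## What is here

* `JsBalBmNAtOf hLc hr … := fun j ↦ dressBmAt hr (JsBal0NAtOf hLc hr … j)` — the Π_bm-co-dressed spine over the NATIVE-placement undressed
  family (`SpineRootedStepN`), + `_apply`, (St♭)/(Wt) `JsBalBmNAtOf_S_translate`/`_W_translate` (an2's `dressBmAtS/W_translate`).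
* **`axisReflectionCovariant_flipK_TbalOf_JsBalBmNAtOf_ctrC`** — the wiring `SpineRooted.axisReflectionCovariant_flipK_TbalOf_JsBalBmAtOf_ctrC`
  VERBATIM with `JsBal0AtOf ↦ JsBal0NAtOf`: `∀ j, AxisReflectionCovariant (flipK (TbalOf Lc (JsBalBmNAtOf …) j))` from EXACTLY a spread
  `𝕄 j` with rules 3–4 against `axEc` (at `j = 0` DISCHARGED with `𝕄 0 := bhKAt d ρ_c Lc`: `BorderedHessianRooted.relInv_coDressKBmAt_KInvStep_zero_bhKAt`),
  contact families commuting with `axEc` (the diagonal contacts of `DiagonalContact` do: `comp_axEc_diagK_comm`), and the conjugated jet laws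
  (Sr-conj)/(Wr-conj) of the UNDRESSED native spine against `𝕄 j` — whose vh- and Λ-parts at `j = 0` are `VhPieceReflection` /
  `LambdaPieceReflection`; the Wilson part (an3's table) and `j ≥ 1` remain binders.

All declarations `[folklore]`; axioms standard.  Provenance: b2b-balaban β sub-cell, unit beta-an2 gen 14, 2026-08-20 (v1); over
`SpineRootedStepN`, `AxialDressingRootedBmHessian` (`axisReflectionCovariant_flipK_TbalOf_dressBmCtr_rel`), `AxialCoordinateProjectorCoarseRules`
BY NAME; no existing file touched.
-/

open Finset
open scoped BigOperators
open Literature.MathematicalPhysics.QuantumFieldTheory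
open Literature.MathematicalPhysics.QuantumFieldTheory.Balaban1983to89
open Literature.MathematicalPhysics.QuantumFieldTheory.Balaban1983to89.Beta
open B12Sec2to5 (l1 l1_nonneg)
open ExpKernelCalculus (MKer Decays BiLoc comp tr VertexFamily VertexFamily₂ shiftK)
open AffineAveraging (Form1 Form2 box toSite)
open AveragingContoursRooted (ctrOff ctrOff_mem_box)
open PolarizationSign (reflSign AxisReflectionCovariant)
open KernelReflection (refK)
open ResolventReflection (bref Φ)
open OneStepResolventKernel (Fib LocStencil JetData)
open OneStepKernelFamily (KInvStep vertexOfK TbalOf flipK)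
open Summit.QuantumFields.BalabanUV.Beta.TameKernelCalculus
open Summit.QuantumFields.BalabanUV.Beta.ChartConjugation (conjV conjW)
open Summit.QuantumFields.BalabanUV.Beta.ChartConjugationRelative (RelInv)
open Summit.QuantumFields.BalabanUV.Beta.AxialDressingRooted (dressBmAt dressBmAt_S dressBmAt_W dressBmAtS_translate dressBmAtW_translate
  coDressKBmAt axEc spr_axEc axEc_rules_coDressKBmAt_KInvStep axisReflectionCovariant_flipK_TbalOf_dressBmCtr_rel one_le_of_neZero)

noncomputable section

namespace Summit.QuantumFields.BalabanUV.Beta.SpineRooted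

variable {d : ℕ}

/-! ## §D1♮ The co-dressed family over the native undressed spine -/

section Family

variable {Lc : ℕ} [NeZero Lc] (hLc : 1 ≤ Lc) {r : Fin (d + 1) → ℕ} (hr : r ∈ box (d + 1) Lc) (cE cVH cΛ : ℝ)
    (W : ℕ → Fin (d + 1) → (Fin (d + 1) → ℤ) → Fin (d + 1) → (Fin (d + 1) → ℤ) → ExpKernelCalculus.MKer (d + 1) (Fib d))
    (Cw δw : ℕ → ℝ) (hδw : ∀ j, 0 < δw j) (hW : ∀ j, VertexFamily₂ (W j) Lc (Cw j) (δw j))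

/-- [folklore] **THE ROOTED Π_bm-CO-DRESSED FAMILY OVER THE NATIVE SPINE**: `JsBalBm♮_ρ := dressBmAt ρ ∘ JsBal⁰♮_ρ`. -/
def JsBalBmNAtOf : ℕ → JetData d Lc := fun j => dressBmAt hr (JsBal0NAtOf hLc hr cE cVH cΛ W Cw δw hδw hW j)

/-- [folklore] `JsBalBm♮_ρ` is `dressBmAt ρ ∘ JsBal⁰♮_ρ`, by definition. -/
theorem JsBalBmNAtOf_apply (j : ℕ) :
    JsBalBmNAtOf hLc hr cE cVH cΛ W Cw δw hδw hW j = dressBmAt hr (JsBal0NAtOf hLc hr cE cVH cΛ W Cw δw hδw hW j) := rfl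

/-- [folklore] **(St♭) FOR `JsBalBm♮_ρ`**, every member — an2's `AxialDressingRooted.dressBmAtS_translate`. -/
theorem JsBalBmNAtOf_S_translate (j : ℕ) (κ' : Fin (d + 1)) (u t : Fin (d + 1) → ℤ) :
    (JsBalBmNAtOf hLc hr cE cVH cΛ W Cw δw hδw hW j).S κ' (u + (Lc : ℤ) • t)
      = shiftK (-((Lc : ℤ) • t)) ((JsBalBmNAtOf hLc hr cE cVH cΛ W Cw δw hδw hW j).S κ' u) := by
  show (dressBmAt hr (JsBal0NAtOf hLc hr cE cVH cΛ W Cw δw hδw hW j)).S κ' (u + (Lc : ℤ) • t)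
    = shiftK (-((Lc : ℤ) • t)) ((dressBmAt hr (JsBal0NAtOf hLc hr cE cVH cΛ W Cw δw hδw hW j)).S κ' u)
  rw [dressBmAt_S, dressBmAt_S]
  exact dressBmAtS_translate (toSite r) hLc (JsBal0NAtOf_S_translate hLc hr cE cVH cΛ W Cw δw hδw hW j) κ' u t

/-- [folklore] **(Wt) FOR `JsBalBm♮_ρ` FROM (Wt) OF THE TABLES** — an2's `AxialDressingRooted.dressBmAtW_translate`. -/
theorem JsBalBmNAtOf_W_translate
    (hWt : ∀ (j : ℕ) (μ : Fin (d + 1)) (y : Fin (d + 1) → ℤ) (ν : Fin (d + 1)) (y' t : Fin (d + 1) → ℤ),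
      W j μ (y + t) ν (y' + t) = shiftK (-((Lc : ℤ) • t)) (W j μ y ν y'))
    (j : ℕ) (μ : Fin (d + 1)) (y : Fin (d + 1) → ℤ) (ν : Fin (d + 1)) (y' t : Fin (d + 1) → ℤ) :
    (JsBalBmNAtOf hLc hr cE cVH cΛ W Cw δw hδw hW j).W μ (y + t) ν (y' + t)
      = shiftK (-((Lc : ℤ) • t)) ((JsBalBmNAtOf hLc hr cE cVH cΛ W Cw δw hδw hW j).W μ y ν y') := by
  show (dressBmAt hr (JsBal0NAtOf hLc hr cE cVH cΛ W Cw δw hδw hW j)).W μ (y + t) ν (y' + t)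
    = shiftK (-((Lc : ℤ) • t)) ((dressBmAt hr (JsBal0NAtOf hLc hr cE cVH cΛ W Cw δw hδw hW j)).W μ y ν y')
  rw [dressBmAt_W, dressBmAt_W, JsBal0NAtOf_W]
  exact dressBmAtW_translate (toSite r) hLc (hWt j) μ y ν y' t

end Family

/-! ## §D2♮ `hR` for the centred co-dressed native spine over the coarse coordinate projector -/

section Wiring

/-- [folklore] **`hR` FOR THE CENTRED Π_bm-CO-DRESSED NATIVE SPINE OVER `axEc`** — the wiring
`axisReflectionCovariant_flipK_TbalOf_JsBalBmAtOf_ctrC` with `JsBal0AtOf ↦ JsBal0NAtOf`: satisfiable sockets (rules 1–2 inside by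
`axEc_rules_coDressKBmAt_KInvStep`; at `j = 0`, h3/h4 hold with `M 0 := bhKAt 3 ρ_c Lc` by
`BorderedHessianRooted.relInv_coDressKBmAt_KInvStep_zero_bhKAt`; diagonal contacts satisfy hEC by `DiagonalContact.comp_axEc_diagK_comm`).
Discharges nothing of the wall by itself. -/
theorem axisReflectionCovariant_flipK_TbalOf_JsBalBmNAtOf_ctrC {Lc : ℕ} [NeZero Lc] (hLc : Odd Lc) (cE cVH cΛ : ℝ)
    (W : ℕ → Fin 4 → (Fin 4 → ℤ) → Fin 4 → (Fin 4 → ℤ) → MKer 4 (Fib 3)) (Cw δw : ℕ → ℝ) (hδw : ∀ j, 0 < δw j)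
    (hW : ∀ j, VertexFamily₂ (W j) Lc (Cw j) (δw j))
    (hWt : ∀ (j : ℕ) (μ : Fin 4) (y : Fin 4 → ℤ) (ν : Fin 4) (y' t : Fin 4 → ℤ),
      W j μ (y + t) ν (y' + t) = shiftK (-((Lc : ℤ) • t)) (W j μ y ν y'))
    (M : ℕ → MKer 4 (Fib 3)) (hM : ∀ j, Spr (M j))
    (h3 : ∀ j, comp (comp (coDressKBmAt (toSite (ctrOff 4 Lc)) Lc (KInvStep (d := 3) Lc j)) (M j)) (axEc (toSite (ctrOff 4 Lc)) Lc) =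
      axEc (toSite (ctrOff 4 Lc)) Lc)
    (h4 : ∀ j, comp (comp (axEc (toSite (ctrOff 4 Lc)) Lc) (M j)) (coDressKBmAt (toSite (ctrOff 4 Lc)) Lc (KInvStep (d := 3) Lc j)) =
      axEc (toSite (ctrOff 4 Lc)) Lc)
    (C : ℕ → Fin 4 → Fin 4 → (Fin 4 → ℤ) → MKer 4 (Fib 3)) (Cc δc : ℕ → ℝ) (hC : ∀ j α, LocStencil (C j α) (Cc j) (δc j))
    (hδc : ∀ j, 0 < δc j) (X₂ : ℕ → Fin 4 → Fin 4 → (Fin 4 → ℤ) → Fin 4 → (Fin 4 → ℤ) → MKer 4 (Fib 3))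
    (hX₂ : ∀ j α μ y ν y', Loc (X₂ j α μ y ν y'))
    (hEC : ∀ j α κ' u, comp (axEc (toSite (ctrOff 4 Lc)) Lc) (C j α κ' u) = comp (C j α κ' u) (axEc (toSite (ctrOff 4 Lc)) Lc))
    (hEX₂ : ∀ j α μ y ν y', comp (axEc (toSite (ctrOff 4 Lc)) Lc) (X₂ j α μ y ν y') = comp (X₂ j α μ y ν y') (axEc (toSite (ctrOff 4 Lc)) Lc))
    (hSrC : ∀ (j : ℕ) (α κ' : Fin 4) (u : Fin 4 → ℤ),
      (JsBal0NAtOf (d := 3) hLc.pos (ctrOff_mem_box hLc.pos) cE cVH cΛ W Cw δw hδw hW j).S κ' (bref α κ' u) =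
        reflSign α κ' • refK (Φ Lc α)
          ((JsBal0NAtOf (d := 3) hLc.pos (ctrOff_mem_box hLc.pos) cE cVH cΛ W Cw δw hδw hW j).S κ' u + conjV (M j) (C j α κ' u)))
    (hWrC : ∀ (j : ℕ) (α μ : Fin 4) (y : Fin 4 → ℤ) (ν : Fin 4) (y' : Fin 4 → ℤ),
      (JsBal0NAtOf (d := 3) hLc.pos (ctrOff_mem_box hLc.pos) cE cVH cΛ W Cw δw hδw hW j).W μ (bref α μ y) ν (bref α ν y') =
        (reflSign α μ * reflSign α ν) • refK (Φ Lc α)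
          ((JsBal0NAtOf (d := 3) hLc.pos (ctrOff_mem_box hLc.pos) cE cVH cΛ W Cw δw hδw hW j).W μ y ν y' +
            conjW (M j)
              (vertexOfK (coDressKBmAt (toSite (ctrOff 4 Lc)) Lc (KInvStep (d := 3) Lc j)) Lc
                (JsBal0NAtOf (d := 3) hLc.pos (ctrOff_mem_box hLc.pos) cE cVH cΛ W Cw δw hδw hW j).S μ y)
              (vertexOfK (coDressKBmAt (toSite (ctrOff 4 Lc)) Lc (KInvStep (d := 3) Lc j)) Lc
                (JsBal0NAtOf (d := 3) hLc.pos (ctrOff_mem_box hLc.pos) cE cVH cΛ W Cw δw hδw hW j).S ν y')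
              (vertexOfK (coDressKBmAt (toSite (ctrOff 4 Lc)) Lc (KInvStep (d := 3) Lc j)) Lc (C j α) μ y)
              (vertexOfK (coDressKBmAt (toSite (ctrOff 4 Lc)) Lc (KInvStep (d := 3) Lc j)) Lc (C j α) ν y') (X₂ j α μ y ν y'))) :
    ∀ j : ℕ, AxisReflectionCovariant
      (flipK (TbalOf Lc (JsBalBmNAtOf (d := 3) hLc.pos (ctrOff_mem_box hLc.pos) cE cVH cΛ W Cw δw hδw hW) j)) := by
  have hR : ∀ j, RelInv (coDressKBmAt (toSite (ctrOff 4 Lc)) Lc (KInvStep (d := 3) Lc j)) (M j) (axEc (toSite (ctrOff 4 Lc)) Lc) :=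
    fun j => ⟨(axEc_rules_coDressKBmAt_KInvStep (ctrOff_mem_box (one_le_of_neZero Lc)) j).1,
      (axEc_rules_coDressKBmAt_KInvStep (ctrOff_mem_box (one_le_of_neZero Lc)) j).2, h3 j, h4 j⟩
  exact axisReflectionCovariant_flipK_TbalOf_dressBmCtr_rel hLc
    (JsBal0NAtOf (d := 3) hLc.pos (ctrOff_mem_box hLc.pos) cE cVH cΛ W Cw δw hδw hW) M (axEc (toSite (ctrOff 4 Lc)) Lc) hM
    (spr_axEc _ _) hR (JsBal0NAtOf_S_translate hLc.pos (ctrOff_mem_box hLc.pos) cE cVH cΛ W Cw δw hδw hW)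
    (JsBal0NAtOf_W_translate hLc.pos (ctrOff_mem_box hLc.pos) cE cVH cΛ W Cw δw hδw hW hWt) C Cc δc hC hδc X₂ hX₂ hEC hEX₂ hSrC hWrC

end Wiring

end Summit.QuantumFields.BalabanUV.Beta.SpineRooted

end
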